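import Summits.QuantumFields.YangMills.Theorems.LuscherReductionTwistedTraceScalingGnomonicMagnetic
import Summits.QuantumFields.YangMills.Theorems.LuscherReductionTwistedTraceScalingGnomonicKineticLattice
import HarnessLib

/-!
# The `L³` transfer kernel in the lattice gnomonic chart IS the harmonic (stiff Gaussian) model kernel up to explicit exponents:
# `e^{2β|E|} e^{−2000|P|ρ³β} k_β(x,x') ≤ K_β(P(w),P(w')) ≤ e^{2β|E|} e^{+2000|P|ρ³β} k_{β(1+ρ²)⁻²}(x,x')` on the bulk `max_e |w_e| ≤ ρ ≤ 1/2`,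
# `k_b(x,x') = e^{−⟪x,Ax⟫} e^{−b‖x−x'‖²} e^{−⟪x',Ax'⟫}`, `A = (β/2)·stiffHessian`, `x = chartVec w`
# (lane B of S-BASE, crux `TwistedTraceScaling` stmt-QuantumFields-20203; the Laplace step of both COARSE lanes)

Composition of `transferKernel_eq_latE_mul` (`K_β = E_β · e^{−(β/2)(S(U)+S(V))}`), the kinetic sandwich `…GnomonicKineticLattice.latE_gnomonic_sandwich`
and the magnetic estimate `…GnomonicMagnetic.abs_wilsonAction_gnomonic_sub_curl_le`, rewritten in the vocabulary of
`Literature.Analysis.OperatorTheory.GaussianTransferKernel` (`e^{−⟪x,Ax⟫}e^{−b‖x−y‖²}e^{−⟪y,Ay⟫}`, whose exact ground state and top eigenvalue are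
`integral_gaussKernel_mul_groundState_symm` / `…StiffHessian.stiff_groundState`).  After `…ChartTransport` (Lebesgue on the chart = volume of `LinkSpace L`,
density `∏_e w(w_e)` two-sided on the bulk) this is the pointwise input of the Laplace comparison `(K_β H)/H ≈ Λ` for the adiabatic Gaussian trial state.
HONEST FRAMING: bookkeeping; femto rung R2b1 (stub of a child of a CONDITIONAL route); not a gap, not Clay.
-/

set_option autoImplicit false

noncomputable section

open scoped BigOperators RealInnerProductSpace
open Literature.MathematicalPhysics.QuantumFieldTheory
open Literature.MathematicalPhysics.QuantumLattice

namespace Summit.QuantumFields.YangMills.Theorems.FemtoTransferGap.TwoLattice.GnChart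

open Summit.QuantumFields.YangMills.Theorems.FemtoTransferGap
open Summit.QuantumFields.YangMills.Theorems.FemtoTransferGap.TwoLattice
open Summit.QuantumFields.YangMills.Theorems.FemtoTransferGap.TwoLattice.Stiff

variable (L : ℕ) [NeZero L]

/-! ## §1 `chartVec` is linear; the kinetic exponent is `‖x − x'‖²` -/

omit [NeZero L] in
/-- `chartVec (w − w') = chartVec w − chartVec w'`. [folklore] -/
theorem chartVec_sub (w w' : Edge 3 L → Fin 3 → ℝ) : chartVec (w - w') = chartVec w - chartVec w' := by
  ext ⟨e, a⟩; rfl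

/-- `Σ_e Σ_a (w_e a − w'_e a)² = ‖chartVec w − chartVec w'‖²`. [folklore] -/
theorem sum_sub_sq_eq_norm_chartVec_sub (w w' : Edge 3 L → Fin 3 → ℝ) :
    ∑ e : Edge 3 L, ∑ a, (w e a - w' e a) ^ 2 = ‖chartVec w - chartVec w'‖ ^ 2 := by
  rw [← chartVec_sub, EuclideanSpace.norm_sq_eq,
    Fintype.sum_prod_type (f := fun ea : Edge 3 L × Fin 3 => ‖chartVec (w - w') ea‖ ^ 2)]
  simp only [chartVec_apply, Pi.sub_apply, Real.norm_eq_abs, sq_abs]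

/-- `⟪x, ((β/2)·H) x⟫ = (β/2)‖d x‖²` for the stiffness Hessian `H = d†d`. [folklore] -/
theorem inner_smul_stiffHessian (β : ℝ) (x : LinkSpace L) : ⟪x, ((β / 2) • stiffHessian L) x⟫ = β / 2 * ‖latCurl L x‖ ^ 2 := by
  rw [LinearMap.smul_apply, real_inner_smul_right, inner_stiffHessian]

/-! ## §2 The sandwich -/

/-- ★ **The true kernel against the harmonic model kernel, on the bulk of the gnomonic chart.**  For `0 ≤ β`, `0 ≤ ρ ≤ 1/2` and chart
coordinates with `Σ_a w_e a² ≤ ρ²`, `Σ_a w'_e a² ≤ ρ²` on every link, writing `x = chartVec w`, `x' = chartVec w'`, `A = (β/2)·stiffHessian L`,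
`n = |E|`, `p = |P|`:
`e^{2βn} e^{−2000pρ³β} · e^{−⟪x,Ax⟫} e^{−β‖x−x'‖²} e^{−⟪x',Ax'⟫} ≤ K_β(P(w),P(w')) ≤ e^{2βn} e^{2000pρ³β} · e^{−⟪x,Ax⟫} e^{−β(1+ρ²)⁻²‖x−x'‖²} e^{−⟪x',Ax'⟫}`.
[cite: Luscher1983, §3] [cite: Wipf2021, §8.5.1] -/
theorem transferKernel_chart_sandwich {β : ℝ} (hβ : 0 ≤ β) {ρ : ℝ} (hρ0 : 0 ≤ ρ) (hρ : ρ ≤ 1 / 2) (w w' : Edge 3 L → Fin 3 → ℝ)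
    (hw : ∀ e, ∑ a, w e a ^ 2 ≤ ρ ^ 2) (hw' : ∀ e, ∑ a, w' e a ^ 2 ≤ ρ ^ 2) :
    Real.exp (2 * β) ^ Fintype.card (Edge 3 L) * Real.exp (-(2000 * Fintype.card (Plaquette 3 L) * ρ ^ 3 * β)) *
          (Real.exp (-⟪chartVec w, ((β / 2) • stiffHessian L) (chartVec w)⟫) *
            Real.exp (-(β * ‖chartVec w - chartVec w'‖ ^ 2)) *
            Real.exp (-⟪chartVec w', ((β / 2) • stiffHessian L) (chartVec w')⟫)) ≤
        transferKernel su2Rep β (latPatternChart L (fun _ => false) w) (latPatternChart L (fun _ => false) w') ∧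
      transferKernel su2Rep β (latPatternChart L (fun _ => false) w) (latPatternChart L (fun _ => false) w') ≤
        Real.exp (2 * β) ^ Fintype.card (Edge 3 L) * Real.exp (2000 * Fintype.card (Plaquette 3 L) * ρ ^ 3 * β) *
          (Real.exp (-⟪chartVec w, ((β / 2) • stiffHessian L) (chartVec w)⟫) *
            Real.exp (-(β / (1 + ρ ^ 2) ^ 2 * ‖chartVec w - chartVec w'‖ ^ 2)) *
            Real.exp (-⟪chartVec w', ((β / 2) • stiffHessian L) (chartVec w')⟫)) := by
  set U := latPatternChart L (fun _ => false) w with hU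
  set V := latPatternChart L (fun _ => false) w' with hV
  rw [transferKernel_eq_latE_mul, inner_smul_stiffHessian, inner_smul_stiffHessian, ← sum_sub_sq_eq_norm_chartVec_sub]
  obtain ⟨hkinL, hkinU⟩ := latE_gnomonic_sandwich L hβ w w' hw hw'
  have hmU := abs_wilsonAction_gnomonic_sub_curl_le L hρ0 hρ w hw
  have hmV := abs_wilsonAction_gnomonic_sub_curl_le L hρ0 hρ w' hw'
  rw [← hU] at hmU hkinL hkinU; rw [← hV] at hmV hkinL hkinU
  set p : ℝ := (Fintype.card (Plaquette 3 L) : ℝ)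
  set cU := ‖latCurl L (chartVec w)‖ ^ 2
  set cV := ‖latCurl L (chartVec w')‖ ^ 2
  have habsU := abs_le.1 hmU
  have habsV := abs_le.1 hmV
  have hE0 : 0 ≤ latE L β U V := (latE_pos β U V).le
  -- the magnetic factor, two-sided
  have hmagL : Real.exp (-(2000 * p * ρ ^ 3 * β)) * (Real.exp (-(β / 2 * cU)) * Real.exp (-(β / 2 * cV))) ≤
      Real.exp (-(β / 2) * (wilsonAction su2Rep U + wilsonAction su2Rep V)) := by
    rw [← Real.exp_add, ← Real.exp_add]
    refine Real.exp_le_exp.2 ?_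
    nlinarith [habsU.2, habsV.2]
  have hmagU : Real.exp (-(β / 2) * (wilsonAction su2Rep U + wilsonAction su2Rep V)) ≤
      Real.exp (2000 * p * ρ ^ 3 * β) * (Real.exp (-(β / 2 * cU)) * Real.exp (-(β / 2 * cV))) := by
    rw [← Real.exp_add, ← Real.exp_add]
    refine Real.exp_le_exp.2 ?_
    nlinarith [habsU.1, habsV.1]
  have hmag0 : 0 ≤ Real.exp (-(β / 2) * (wilsonAction su2Rep U + wilsonAction su2Rep V)) := (Real.exp_pos _).le
  constructor
  · calc Real.exp (2 * β) ^ Fintype.card (Edge 3 L) * Real.exp (-(2000 * p * ρ ^ 3 * β)) *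
          (Real.exp (-(β / 2 * cU)) * Real.exp (-(β * ∑ e : Edge 3 L, ∑ a, (w e a - w' e a) ^ 2)) * Real.exp (-(β / 2 * cV)))
        = (Real.exp (2 * β) ^ Fintype.card (Edge 3 L) * Real.exp (-(β * ∑ e : Edge 3 L, ∑ a, (w e a - w' e a) ^ 2))) *
            (Real.exp (-(2000 * p * ρ ^ 3 * β)) * (Real.exp (-(β / 2 * cU)) * Real.exp (-(β / 2 * cV)))) := by ring
      _ ≤ latE L β U V * Real.exp (-(β / 2) * (wilsonAction su2Rep U + wilsonAction su2Rep V)) :=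
          mul_le_mul hkinL hmagL (by positivity) hE0
  · calc latE L β U V * Real.exp (-(β / 2) * (wilsonAction su2Rep U + wilsonAction su2Rep V))
        ≤ (Real.exp (2 * β) ^ Fintype.card (Edge 3 L) *
              Real.exp (-(β / (1 + ρ ^ 2) ^ 2 * ∑ e : Edge 3 L, ∑ a, (w e a - w' e a) ^ 2))) *
            (Real.exp (2000 * p * ρ ^ 3 * β) * (Real.exp (-(β / 2 * cU)) * Real.exp (-(β / 2 * cV)))) :=
          mul_le_mul hkinU hmagU hmag0 (by positivity)
      _ = Real.exp (2 * β) ^ Fintype.card (Edge 3 L) * Real.exp (2000 * p * ρ ^ 3 * β) *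
          (Real.exp (-(β / 2 * cU)) * Real.exp (-(β / (1 + ρ ^ 2) ^ 2 * ∑ e : Edge 3 L, ∑ a, (w e a - w' e a) ^ 2)) *
            Real.exp (-(β / 2 * cV))) := by ring

omit [NeZero L] in
/-- On the bulk both chart configurations lie in the Frobenius ball `‖U_e − 1‖_F² ≤ 2ρ² < 4` (so bulk cut-offs are vacuum-pattern supported,
cf. `…VacuumPattern.integral_configMeasure_eq_vacuumChart_of_frobNorm`). [folklore] -/
theorem frobNorm_latPatternChart_sub_one_sq_le {ρ : ℝ} (w : Edge 3 L → Fin 3 → ℝ) (hw : ∀ e, ∑ a, w e a ^ 2 ≤ ρ ^ 2) (e : Edge 3 L) :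
    frobNorm ((latPatternChart L (fun _ => false) w e : Matrix (Fin 2) (Fin 2) ℂ) - 1) ^ 2 ≤ 2 * ρ ^ 2 := by
  have h := (link_chart_bounds (w e)).1
  rw [latPatternChart_false]
  have h0 : 0 ≤ ∑ a, w e a ^ 2 := Finset.sum_nonneg fun a _ => sq_nonneg _
  nlinarith [hw e, h]

end Summit.QuantumFields.YangMills.Theorems.FemtoTransferGap.TwoLattice.GnChart

end
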